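import Summits.QuantumFields.YangMills.Theorems.BalabanUVNodesN15DefectKernelHk163
import Literature.MathematicalPhysics.QuantumFieldTheory.Balaban1983to89.B5Hk163RatePosition
import Literature.MathematicalPhysics.QuantumFieldTheory.Balaban1983to89.B5Hk163RDiv
import HarnessLib

/-!
# Route «BalabanUVNodes» (K4 «SpineRates»), node N15 = NE2, THE -a ∕ -b INTERFACE OF THE BACKGROUND LAYER, part 11: THE DERIVATIVE ENTRY — the
# two-lattice η-rate of `∂_νH_k` (Bałaban's (1.63) at `U = 1`) through King's pairing, with decay by interpolation (King's (3.71), SECOND line, vector sibling)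

Cell `pub-ymgap`, seat `pub-ymgap-dag-n15-a` (KNIT-BY-NAME, generation g3; HUMAN RULING D-0062; chair R424 venue; `bears_on: R4∕N15`).  Filed
`--supports stmt-QuantumFields-19351` (helper).  THEOREMS ONLY; imports BY NAME, nothing in the tree modified: part 8 `…DefectKernelHk163` (this seat:
`pr_bpt`, `corner_le_and_steps`, `blockOf_bpt_king`, `tdistT_eq_torusSupNorm_rep`, part 1's `hasMaj_ofBlocks_of_entry_le`, `idef_id_pull_single_apply`
through it), the b05 lineage `B5Hk163TorusHolder` (`dker` = the kernel of the typed `∂_νH_k = fdiff·HkOp`, `fdiff_HkOp_apply`, `exp_shiftr_eq_exp_symmAlias`),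
`B5Hk163TorusHolderDecay` (`D163`, `dgker`, `dker_bpt`, `norm_dker_bpt_le`, `interp_le`, `MD163`), `B5Hk163RDiv` (`h163_zero_of_ne`), `B5Hk163Torus`
(`dC_zero163`), and the P1 lineage `B5Hk163RatePosition` (`kerFib`, `kerFib_rate`, `kerFib_holder_le` — King's §4 (4.24)∕(4.26) transferred to (1.63):
the fixed-fibre sup-norm rate `T163(d,0,γ)·N^{−γ}` and the level-uniform Hölder modulus, real momenta `p′ ≠ 0`).

WHY (HANDOFF g3.2 (e); n15-b's `…N15BackgroundEntries` «entries 1, 3: … four pieces: 𝔇(D₁′, D₁) [NE2⁰ DERIVATIVE entry], …»).  Part 8 gave the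
two-lattice rate of `H_k` itself (entry 0 of (3.42) for the vector piece); the DERIVATIVE entries of the background step need the NE2⁰ defect of
`D₁ = ∇H` — the vector sibling of the SECOND line of King's (3.71), `|∂^{η′}_μ a_{k+n}G_{k+n}Q*_{k+n}(x′, z) − ∂^η_μ a_kG_kQ*_k(x, z)| ≤ CL^{−γk}e^{−δ₀|x−z|}`
(scalar template landed today by n18-b, `King1986.MinimizerAliasRateDeriv`).  For Bałaban's `H_k` the P1 lineage holds the momentum-side ingredients at a
FIXED FIBRE `p′ ≠ 0` WITHOUT decay (`kerFib_rate`: same position, rate `N^{−γ}`, `γ < 1`; `kerFib_holder_le`: Hölder modulus in the position,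
exponent `α < 1`), and b05 holds the DECAY of `∂_νH_k`'s kernel (`norm_dker_bpt_le`).  THIS FILE assembles them: (i) the dictionary
`D_{ν,a}(p′) = kerFib(p′, a∕n)` between b05's derivative multiplier and P1's fixed-fibre kernel (`D163_ofRealVec_eq_kerFib`) and the vanishing of
the zero fibre (`D163_zero`); (ii) King's pairing = corner (same position, `kerFib_rate`) + within-block displacement `|a′∕(Rn) − â∕n|₁ ≤ (d+1)∕n`
(`kerFib_holder_le`) ⇒ the fibrewise rate `ρ_D(n) = T163(d,0,γ)n^{−γ} + 2^{1−α}((d+1)∕n)^α·K_α`; (iii) the torus kernel = fibre average ⇒ the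
SAME bound for `|∂′_νH_{Rn}((x′,μ),(y,λ)) − ∂_νH_n((pr x′,μ),(y,λ))|` uniformly (no decay); (iv) interpolation with the decay of both kernels
(`interp_le`, `θ = 1∕2`): **`‖∂′H′(x′, y) − ∂H(pr x′, y)‖ ≤ √(ρ_D(n)·2MD163·periodConst)·e^{−(δ_H∕2)|B(x′) − y|_T}`** — rate `n^{−min(α,γ)∕2}`, decay
`δ_H∕2` («γ sufficiently small», as in King); (v) binder (a)'s format `hasMaj_idef_dhk163`.

THE PRINT (objects and shapes only; NO η-rate of `∂H_k` is printed — nothing printed is a hypothesis).  [Balaban1984PropagatorsI] (1.63) p. 28 and p. 28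
last lines – p. 29 l. 2 («the sum over l of the absolute value of this expression multiplied by |∂_ν(p′+l)||p′+l|^α is bounded … This implies bounds on
(1∕|x′−x|^α)|∂_ν(H_kB)_μ(x′) − ∂_ν(H_kB)_μ(x)|»); King CMP **102** (1986) Prop. 3.8 (3.71) p. 664 second line (shape), §4 (4.24)–(4.26) p. 673 (mechanism),
p. 674 «combining our bounds with Theorem 3.3» (the interpolation).

HONEST FRAMING ∕ LIMITS.  `U = 1` linear theory on finite tori, `d + 1 ≥ 1`; rate exponent `min(α,γ)∕2 < 1∕2` and decay `δ_H∕2` (interpolation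
artefacts; King's own second line has «γ sufficiently small»); constants crude, dimension-only; the `Δ_UG` entry (second differences) is NOT covered
(no printed∕tree input); nothing with background (NE2⁺ NOT PRINTED ∕ not proved); count-neutral; NOT a discharge of N15; one finite T⁴ at fixed ε —
NOT infinite volume, NOT OS on ℝ⁴, NOT a mass gap, NOT Clay.
-/

noncomputable section

open scoped BigOperators ComplexConjugate
open Finset Complex

namespace Summit.QuantumFields.YangMills.BalabanUVNodes.N15.DefectKernel

open Literature.MathematicalPhysics.QuantumFieldTheory.Balaban1983to89
open Literature.MathematicalPhysics.QuantumFieldTheory.Balaban1983to89.B11SectG (BlockNorm HasMaj)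
open Literature.MathematicalPhysics.QuantumFieldTheory.Balaban1983to89.T4EtaRateDefect (idef)
open Literature.MathematicalPhysics.QuantumFieldTheory.Balaban1983to89.T4EtaRateCoeffDefect (pull fibre)
open Literature.MathematicalPhysics.QuantumFieldTheory.Balaban1983to89.B4Strip (ofRealVec shift shiftr)
open Literature.MathematicalPhysics.QuantumFieldTheory.Balaban1983to89.B4TorusKernel (periodConst)
open Literature.MathematicalPhysics.QuantumFieldTheory.Balaban1983to89.B4TorusKernel.MultiPeriod (torusSupNorm)
open Literature.MathematicalPhysics.QuantumFieldTheory.Balaban1983to89.B5Prop11Plancherel (Tor chi fine sOf abs_sOf_le sOf_ne_zero sOf_zero)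
open Literature.MathematicalPhysics.QuantumFieldTheory.Balaban1983to89.B5Prop11Fiber (dSym)
open Literature.MathematicalPhysics.QuantumFieldTheory.Balaban1983to89.B5Block118 (bpt)
open Literature.MathematicalPhysics.QuantumFieldTheory.Balaban1983to89.B5Blocks16 (bpt_val bpt_bijective)
open Literature.MathematicalPhysics.QuantumFieldTheory.Balaban1983to89.B5Hk163Strip (dC h163 kappa163 kappa163_pos dC_ofReal)
open Literature.MathematicalPhysics.QuantumFieldTheory.Balaban1983to89.B5Hk163Decay (phase163)
open Literature.MathematicalPhysics.QuantumFieldTheory.Balaban1983to89.B5Hk163Torus (HkOp dC_zero163)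
open Literature.MathematicalPhysics.QuantumFieldTheory.Balaban1983to89.B5Hk163TorusHolder (dker fdiff_HkOp_apply exp_shiftr_eq_exp_symmAlias)
open Literature.MathematicalPhysics.QuantumFieldTheory.Balaban1983to89.B5Hk163TorusHolderDecay (dgker MD163 dker_bpt norm_dker_bpt_le
  dgker_toT_eq_torusKernel torusKernel_D163_decay interp_le)
open Literature.MathematicalPhysics.QuantumFieldTheory.Balaban1983to89.B5Hk163RDiv (h163_zero_of_ne)
open Literature.MathematicalPhysics.QuantumFieldTheory.Balaban1983to89.B5Hk163RateSum (C0maj C1maj T163)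
open Literature.MathematicalPhysics.QuantumFieldTheory.Balaban1983to89.B5Hk163RatePosition (l1 l1_nonneg phase kerFib kerFib_rate
  kerFib_holder_le norm_kerFib_le)
open Literature.MathematicalPhysics.QuantumFieldTheory.Balaban1983to89.B5Kernel166Decay (toT_sub)
open Literature.MathematicalPhysics.QuantumFieldTheory.Balaban1983to89.B6LowerBound2153Torus (toT rep toT_rep)
open Literature.MathematicalPhysics.QuantumFieldTheory.Balaban1983to89.B6Cov2156Torus (one_le_M)
open Literature.MathematicalPhysics.QuantumFieldTheory.King1986 (symmAlias aliasConst)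
open Literature.MathematicalPhysics.QuantumFieldTheory.King1986.Torus (blockOf tdistT)

variable {d : ℕ}

/-! ## §1 The dictionary: b05's derivative multiplier at a real momentum IS P1's fixed-fibre kernel at the lattice offset -/

section Dictionary

variable (n : ℕ) [NeZero n]

omit [NeZero n] in
/-- The fine-offset phase at a real momentum IS P1's plane wave of the centred alias at the position `a∕n`:
`Π_ν e^{i(p′+l)_ν a_ν∕n} = e^{i q̃·(a∕n)}` (`q̃ = symmAlias`; the pull-back by `2πn` costs `e^{2πi·a_ν} = 1`). [folklore] -/
theorem phase163_ofRealVec_eq_phase [NeZero n] (k a : Fin d → Fin n) (s : Fin d → ℝ) :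
    phase163 n k a (ofRealVec s) = phase (symmAlias n k s) (fun ν => ((a ν : ℕ) : ℝ) / n) := by
  unfold phase163 phase B5Hk163RatePosition.dotR
  have hfac : ∀ ν, Complex.exp (shift n k (ofRealVec s) ν / n * I) ^ (a ν : ℕ)
      = Complex.exp (((symmAlias n k s ν * (((a ν : ℕ) : ℝ) / n) : ℝ) : ℂ) * I) := by
    intro ν
    rw [← Complex.exp_nat_mul, B5Hk163Strip.shift_ofRealVec_apply]
    have h := exp_shiftr_eq_exp_symmAlias n k s ν ((a ν : ℕ) : ℤ)
    push_cast at h ⊢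
    rw [show ((a ν : ℕ) : ℂ) * ((shiftr n k s ν : ℂ) / (n : ℂ) * I) = (shiftr n k s ν : ℂ) * ((a ν : ℕ) : ℂ) / (n : ℂ) * I by ring, h]
    ring_nf
  simp_rw [hfac]
  rw [← Complex.exp_sum]
  congr 1
  push_cast
  rw [Finset.sum_mul]

/-- **THE DICTIONARY**: at a real momentum `p′`, b05's derivative multiplier of fine offset `a` IS P1's fixed-fibre kernel at the position `a∕n`:
`D_{ν,a}(p′) = kerFib(p′, a∕n) = Σ_l ∂_ν(q̃_l)·h_{l;μλ}(p′)·e^{iq̃_l·a∕n}` (`B5Hk163Strip.dC_ofReal`, `phase163_ofRealVec_eq_phase`). [folklore] -/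
theorem D163_ofRealVec_eq_kerFib (μ lam ν : Fin d) (a : Fin d → Fin n) (s : Fin d → ℝ) :
    B5Hk163TorusHolderDecay.D163 n μ lam ν a (ofRealVec s) = kerFib n μ lam ν s (fun i => ((a i : ℕ) : ℝ) / n) := by
  unfold B5Hk163TorusHolderDecay.D163 kerFib B5Hk163RatePosition.coef
  refine Finset.sum_congr rfl fun k _ => ?_
  rw [phase163_ofRealVec_eq_phase n k a s, dC_ofReal]
  ring

/-- **THE ZERO FIBRE VANISHES**: `D_{ν,a}(0) = 0` — the alias `l = 0` carries `∂_ν(0) = 0` (`dC_zero163`), every other alias carries `h_{l;μλ}(0) = 0`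
(`B5Hk163RDiv.h163_zero_of_ne`). [folklore] -/
theorem D163_zero (μ lam ν : Fin d) (a : Fin d → Fin n) : B5Hk163TorusHolderDecay.D163 n μ lam ν a (0 : Fin d → ℂ) = 0 := by
  unfold B5Hk163TorusHolderDecay.D163
  refine Finset.sum_eq_zero fun k _ => ?_
  by_cases hk : k = fun _ => 0
  · subst hk
    rw [dC_zero163, mul_zero, zero_mul]
  · rw [h163_zero_of_ne n μ lam hk, mul_zero]

end Dictionary

/-! ## §3 The fibrewise two-lattice rate of the derivative multiplier through King's pairing (no decay) -/

section Fibre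

variable (R n : ℕ) [NeZero R] [NeZero n]

/-- The within-block displacement of King's pairing in P1's position variable: `|a′∕(Rn) − â∕n|₁ ≤ (d+1)∕n` for `⌊a′∕R⌋ = â`
(each coordinate of `a′ − Râ` lies in `[0, R)`). [cite: King1986, p.664 («x′ ∈ B^n(x)»)] -/
theorem l1_pair_le (a' : Fin (d + 1) → Fin (R * n)) (ah : Fin (d + 1) → Fin n) (hover : ∀ i, (a' i : ℕ) / R = (ah i : ℕ)) :
    l1 ((fun i => ((a' i : ℕ) : ℝ) / ((R * n : ℕ) : ℝ)) - fun i => ((ah i : ℕ) : ℝ) / (n : ℝ)) ≤ ((d + 1 : ℕ) : ℝ) / n := by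
  have hR : 0 < R := Nat.pos_of_ne_zero (NeZero.ne R)
  have hn : 0 < n := Nat.pos_of_ne_zero (NeZero.ne n)
  have hRr : (0 : ℝ) < R := Nat.cast_pos.mpr hR
  have hnr : (0 : ℝ) < n := Nat.cast_pos.mpr hn
  have hcoord : ∀ i, |((a' i : ℕ) : ℝ) / ((R * n : ℕ) : ℝ) - ((ah i : ℕ) : ℝ) / (n : ℝ)| ≤ 1 / n := by
    intro i
    have h1 : R * (ah i : ℕ) ≤ (a' i : ℕ) := by rw [← hover i]; exact Nat.mul_div_le _ _
    have h2 : (a' i : ℕ) < R * ((ah i : ℕ) + 1) := by rw [← hover i]; exact Nat.lt_mul_div_succ _ hR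
    have h1r : (R : ℝ) * ((ah i : ℕ) : ℝ) ≤ ((a' i : ℕ) : ℝ) := by exact_mod_cast h1
    have h2r : ((a' i : ℕ) : ℝ) ≤ (R : ℝ) * ((ah i : ℕ) : ℝ) + R := by
      have : ((a' i : ℕ) : ℝ) < (R : ℝ) * (((ah i : ℕ) : ℝ) + 1) := by exact_mod_cast h2
      linarith
    have e : ((a' i : ℕ) : ℝ) / ((R * n : ℕ) : ℝ) - ((ah i : ℕ) : ℝ) / (n : ℝ)
        = (((a' i : ℕ) : ℝ) - (R : ℝ) * ((ah i : ℕ) : ℝ)) / ((R : ℝ) * n) := by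
      rw [Nat.cast_mul]
      field_simp
    rw [e, abs_of_nonneg (div_nonneg (by linarith) (mul_pos hRr hnr).le), div_le_div_iff₀ (mul_pos hRr hnr) hnr]
    nlinarith
  unfold l1
  calc ∑ j, |(((fun i => ((a' i : ℕ) : ℝ) / ((R * n : ℕ) : ℝ)) - fun i => ((ah i : ℕ) : ℝ) / (n : ℝ)) j)|
      ≤ ∑ _j : Fin (d + 1), 1 / (n : ℝ) := Finset.sum_le_sum fun j _ => hcoord j
    _ = ((d + 1 : ℕ) : ℝ) / n := by
        rw [Finset.sum_const, Finset.card_univ, Fintype.card_fin, nsmul_eq_mul]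
        push_cast
        ring

/-- **THE FIBREWISE TWO-LATTICE RATE OF THE DERIVATIVE MULTIPLIER THROUGH KING'S PAIRING** (no decay): at every real momentum `p′ ∈ [−π,π]^{d+1}`,
`|p′| ≠ 0`, for fine offsets `a′` over `â`:
`‖D^{(Rn)}_{ν,a′}(p′) − D^{(n)}_{ν,â}(p′)‖ ≤ 2^{1−α}((d+1)∕n)^α·(C₀π^{1+α} + C₁·aliasConst_{d+1}(α)) + T163(d+1, 0, γ)·n^{−γ}` —
the Hölder modulus of the FINER kernel across the within-block displacement (`kerFib_holder_le`, `0 ≤ α < 1`) plus the same-position rate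
(`kerFib_rate`, `0 < γ < 1`). [cite: King1986, (4.24)–(4.26) p.673 (mechanism); Balaban1984PropagatorsI, p.28 (the weighted alias sums)] -/
theorem norm_D163_pair_sub_le {α γ : ℝ} (hα0 : 0 ≤ α) (hα1 : α < 1) (hγ0 : 0 < γ) (hγ1 : γ < 1) (μ lam ν : Fin (d + 1))
    (a' : Fin (d + 1) → Fin (R * n)) (ah : Fin (d + 1) → Fin n) (hover : ∀ i, (a' i : ℕ) / R = (ah i : ℕ))
    (s : Fin (d + 1) → ℝ) (hs : ∀ i, |s i| ≤ Real.pi) (hs0 : s ≠ 0) :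
    ‖B5Hk163TorusHolderDecay.D163 (R * n) μ lam ν a' (ofRealVec s) - B5Hk163TorusHolderDecay.D163 n μ lam ν ah (ofRealVec s)‖
      ≤ 2 ^ (1 - α) * (((d + 1 : ℕ) : ℝ) / n) ^ α * (C0maj (d + 1) * (Real.pi * Real.pi ^ α) + C1maj (d + 1) * aliasConst (d + 1) α)
        + T163 (d + 1) 0 γ / (n : ℝ) ^ γ := by
  have hR : 1 ≤ R := Nat.pos_of_ne_zero (NeZero.ne R)
  have hn : 1 ≤ n := Nat.pos_of_ne_zero (NeZero.ne n)
  have hRn : 1 ≤ R * n := Nat.one_le_iff_ne_zero.mpr (NeZero.ne (R * n))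
  obtain ⟨ν₀, hν₀⟩ : ∃ ν₀, s ν₀ ≠ 0 := Function.ne_iff.mp hs0
  rw [D163_ofRealVec_eq_kerFib, D163_ofRealVec_eq_kerFib]
  set x' : Fin (d + 1) → ℝ := fun i => ((a' i : ℕ) : ℝ) / ((R * n : ℕ) : ℝ) with hx'
  set x : Fin (d + 1) → ℝ := fun i => ((ah i : ℕ) : ℝ) / (n : ℝ) with hx
  have hK : 0 ≤ C0maj (d + 1) * (Real.pi * Real.pi ^ α) + C1maj (d + 1) * aliasConst (d + 1) α := by
    -- read the sign off the Hölder bound at displacement `|0 − 1|₁ = d + 1`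
    have h := (norm_nonneg _).trans (kerFib_holder_le (Nat.succ_pos d) hα0 hα1 hn s hs ν₀ hν₀ μ lam ν 0 (fun _ => (1 : ℝ)))
    have hl : l1 ((0 : Fin (d + 1) → ℝ) - fun _ => (1 : ℝ)) = ((d + 1 : ℕ) : ℝ) := by
      unfold l1; simp
    rw [hl] at h
    have hpos : 0 < (2 : ℝ) ^ (1 - α) * (((d + 1 : ℕ) : ℝ)) ^ α :=
      mul_pos (Real.rpow_pos_of_pos (by norm_num) _) (Real.rpow_pos_of_pos (by positivity) _)
    nlinarith
  have h1 := kerFib_holder_le (Nat.succ_pos d) hα0 hα1 hRn s hs ν₀ hν₀ μ lam ν x' x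
  have h2 := kerFib_rate (Nat.succ_pos d) hγ0 hγ1 (N := n) (R := R) hn hR s hs ν₀ hν₀ μ lam ν x
  have hl1 : l1 (x' - x) ^ α ≤ (((d + 1 : ℕ) : ℝ) / n) ^ α :=
    Real.rpow_le_rpow (l1_nonneg _) (l1_pair_le R n a' ah hover) hα0
  calc ‖kerFib (R * n) μ lam ν s x' - kerFib n μ lam ν s x‖
      = ‖(kerFib (R * n) μ lam ν s x' - kerFib (R * n) μ lam ν s x) + (kerFib (R * n) μ lam ν s x - kerFib n μ lam ν s x)‖ := by
        rw [sub_add_sub_cancel]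
    _ ≤ ‖kerFib (R * n) μ lam ν s x' - kerFib (R * n) μ lam ν s x‖ + ‖kerFib (R * n) μ lam ν s x - kerFib n μ lam ν s x‖ :=
        norm_add_le _ _
    _ ≤ 2 ^ (1 - α) * l1 (x' - x) ^ α * (C0maj (d + 1) * (Real.pi * Real.pi ^ α) + C1maj (d + 1) * aliasConst (d + 1) α)
          + T163 (d + 1) 0 γ / (n : ℝ) ^ γ := add_le_add h1 h2
    _ ≤ _ := by
        exact add_le_add (mul_le_mul_of_nonneg_right (mul_le_mul_of_nonneg_left hl1
          (Real.rpow_nonneg (by norm_num : (0 : ℝ) ≤ 2) _)) hK) le_rfl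

end Fibre

/-! ## §4 The torus kernels: the same bound for `∂′_νH_{Rn}(x′, y) − ∂_νH_n(pr x′, y)`, uniformly (no decay) -/

section Kernel

variable (R n : ℕ) [NeZero R] [NeZero n] (M : Fin (d + 1) → ℕ) [hM : ∀ μ, NeZero (M μ)]

/-- The fibrewise bound is non-negative (read off the same-position rate at the fibre `p′ = (π, …, π)`). [folklore] -/
theorem rateD_nonneg {α γ : ℝ} (hα0 : 0 ≤ α) (hα1 : α < 1) (hγ0 : 0 < γ) (hγ1 : γ < 1) (μ lam ν : Fin (d + 1)) :
    0 ≤ 2 ^ (1 - α) * (((d + 1 : ℕ) : ℝ) / n) ^ α * (C0maj (d + 1) * (Real.pi * Real.pi ^ α) + C1maj (d + 1) * aliasConst (d + 1) α)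
        + T163 (d + 1) 0 γ / (n : ℝ) ^ γ := by
  have hs : ∀ i : Fin (d + 1), |(fun _ : Fin (d + 1) => Real.pi) i| ≤ Real.pi := fun i => by
    simp [abs_of_pos Real.pi_pos]
  have hs0 : (fun _ : Fin (d + 1) => Real.pi) ≠ 0 := by
    intro h; have := congrFun h 0; simp [Real.pi_ne_zero] at this
  exact (norm_nonneg _).trans (norm_D163_pair_sub_le 1 n hα0 hα1 hγ0 hγ1 μ lam ν (fun _ => (0 : Fin (1 * n))) (fun _ => (0 : Fin n))
    (fun i => by simp) _ hs hs0)

/-- **THE TWO-LATTICE RATE OF THE DERIVATIVE KERNEL THROUGH KING'S PAIRING, UNIFORM (no decay).**  In block coordinates: for the unit block `y′`,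
fine offsets `a′` over `â` and any unit point `y`, `‖∂′_νH_{Rn}((Rn·y′ + a′, μ), (y, λ)) − ∂_νH_n((n·y′ + â, μ), (y, λ))‖ ≤ ρ_D(n)` (the torus kernel is the
fibre average `|T₁|⁻¹Σ_{p′}` of §3's multipliers; the zero fibre contributes nothing, `D163_zero`). [cite: King1986, Prop. 3.8 (3.71) p.664 (second line, shape); Balaban1984PropagatorsI, (1.63) p.28] -/
theorem norm_dker_twoLattice_sub_le {α γ : ℝ} (hα0 : 0 ≤ α) (hα1 : α < 1) (hγ0 : 0 < γ) (hγ1 : γ < 1) (μ lam ν : Fin (d + 1))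
    (a' : Fin (d + 1) → Fin (R * n)) (ah : Fin (d + 1) → Fin n) (hover : ∀ i, (a' i : ℕ) / R = (ah i : ℕ)) (y' y : Tor M) :
    ‖dker (R * n) M μ lam ν (bpt (R * n) M y' a') y - dker n M μ lam ν (bpt n M y' ah) y‖
      ≤ 2 ^ (1 - α) * (((d + 1 : ℕ) : ℝ) / n) ^ α * (C0maj (d + 1) * (Real.pi * Real.pi ^ α) + C1maj (d + 1) * aliasConst (d + 1) α)
        + T163 (d + 1) 0 γ / (n : ℝ) ^ γ := by
  set B : ℝ := 2 ^ (1 - α) * (((d + 1 : ℕ) : ℝ) / n) ^ α *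
      (C0maj (d + 1) * (Real.pi * Real.pi ^ α) + C1maj (d + 1) * aliasConst (d + 1) α) + T163 (d + 1) 0 γ / (n : ℝ) ^ γ with hBdef
  have hB : 0 ≤ B := rateD_nonneg n hα0 hα1 hγ0 hγ1 μ lam ν
  have hcard : (0 : ℝ) < Fintype.card (Tor M) := by exact_mod_cast Fintype.card_pos
  -- fibrewise bound (zero fibre separately)
  have hfib : ∀ q : Tor M, ‖chi M q (y' - y) *
      (B5Hk163TorusHolderDecay.D163 (R * n) μ lam ν a' (ofRealVec (sOf M q))
        - B5Hk163TorusHolderDecay.D163 n μ lam ν ah (ofRealVec (sOf M q)))‖ ≤ B := by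
    intro q
    rw [norm_mul, Beta.WoodburyFibre.norm_chi, one_mul]
    by_cases hq : q = 0
    · subst hq
      rw [sOf_zero, B5Hk163Torus.ofRealVec_zero, D163_zero, D163_zero, sub_self, norm_zero]
      exact hB
    · exact norm_D163_pair_sub_le R n hα0 hα1 hγ0 hγ1 μ lam ν a' ah hover (sOf M q) (abs_sOf_le M q) (sOf_ne_zero M hq)
  rw [dker_bpt, dker_bpt]
  unfold B5Hk163TorusHolderDecay.dgker
  rw [← mul_sub, ← Finset.sum_sub_distrib, norm_mul, norm_inv, Complex.norm_natCast]
  simp_rw [← mul_sub]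
  refine (mul_le_mul_of_nonneg_left (norm_sum_le _ _) (inv_nonneg.mpr hcard.le)).trans ?_
  calc (Fintype.card (Tor M) : ℝ)⁻¹ * ∑ q : Tor M, ‖chi M q (y' - y) *
        (B5Hk163TorusHolderDecay.D163 (R * n) μ lam ν a' (ofRealVec (sOf M q))
          - B5Hk163TorusHolderDecay.D163 n μ lam ν ah (ofRealVec (sOf M q)))‖
      ≤ (Fintype.card (Tor M) : ℝ)⁻¹ * ∑ _q : Tor M, B :=
        mul_le_mul_of_nonneg_left (Finset.sum_le_sum fun q _ => hfib q) (inv_nonneg.mpr hcard.le)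
    _ = B := by
        rw [Finset.sum_const, Finset.card_univ, nsmul_eq_mul, ← mul_assoc, inv_mul_cancel₀ hcard.ne', one_mul]

/-- **… WITH DECAY, BY INTERPOLATION** («combining our bounds with Theorem 3.3»): both kernels decay from the unit block,
`‖∂H(n·y′ + a, y)‖ ≤ MD163·periodConst·e^{−δ_H|y′ − y|_T}` (`norm_dker_bpt_le`), so the geometric mean (`interp_le`, `θ = 1∕2`) of the uniform rate
`ρ_D(n)` and the decay bound `2·MD163·periodConst·e^{−δ_H t}` gives
`‖∂′H′ − ∂H‖ ≤ (ρ_D(n))^{1∕2}·(2·MD163·periodConst)^{1∕2}·e^{−(δ_H∕2)·|y′ − y|_T}` (integer representatives `x′, x` of `y′, y`).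
[cite: King1986, p.674 («combining our bounds with Theorem 3.3 we deduce (3.71)»); Prop. 3.8 (3.71) p.664 (second line, shape)] -/
theorem norm_dker_twoLattice_sub_le_decay {α γ : ℝ} (hα0 : 0 ≤ α) (hα1 : α < 1) (hγ0 : 0 < γ) (hγ1 : γ < 1) (μ lam ν : Fin (d + 1))
    (a' : Fin (d + 1) → Fin (R * n)) (ah : Fin (d + 1) → Fin n) (hover : ∀ i, (a' i : ℕ) / R = (ah i : ℕ)) (x' x : Fin (d + 1) → ℤ) :
    ‖dker (R * n) M μ lam ν (bpt (R * n) M (toT M x') a') (toT M x) - dker n M μ lam ν (bpt n M (toT M x') ah) (toT M x)‖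
      ≤ (2 ^ (1 - α) * (((d + 1 : ℕ) : ℝ) / n) ^ α * (C0maj (d + 1) * (Real.pi * Real.pi ^ α) + C1maj (d + 1) * aliasConst (d + 1) α)
            + T163 (d + 1) 0 γ / (n : ℝ) ^ γ) ^ (1 / 2 : ℝ)
          * (2 * (MD163 (d + 1) * periodConst (kappa163 (d + 1)) d)) ^ (1 / 2 : ℝ)
          * Real.exp (-(kappa163 (d + 1) / (d + 1) / 2 * torusSupNorm M (x' - x))) := by
  have hA := norm_dker_twoLattice_sub_le R n M hα0 hα1 hγ0 hγ1 μ lam ν a' ah hover (toT M x') (toT M x)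
  have hd1 := norm_dker_bpt_le (R * n) M μ lam ν a' x' x
  have hd2 := norm_dker_bpt_le n M μ lam ν ah x' x
  set E : ℝ := Real.exp (-(kappa163 (d + 1) / (d + 1) * torusSupNorm M (x' - x))) with hE
  have hMDpC : 0 ≤ MD163 (d + 1) * periodConst (kappa163 (d + 1)) d := B5Hk163TorusHolderDecay.CdecD_nonneg (d := d)
  have hB : ‖dker (R * n) M μ lam ν (bpt (R * n) M (toT M x') a') (toT M x) - dker n M μ lam ν (bpt n M (toT M x') ah) (toT M x)‖
      ≤ 2 * (MD163 (d + 1) * periodConst (kappa163 (d + 1)) d) * E := by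
    refine (norm_sub_le _ _).trans ?_
    linarith
  have hX := interp_le (norm_nonneg _) hA hB (by norm_num : (0 : ℝ) ≤ 1 / 2) (by norm_num : (1 / 2 : ℝ) ≤ 1)
  refine hX.trans (le_of_eq ?_)
  rw [show (1 : ℝ) - 1 / 2 = 1 / 2 by norm_num,
    Real.mul_rpow (mul_nonneg zero_le_two hMDpC) (Real.exp_pos _).le]
  have hexp : E ^ (1 / 2 : ℝ) = Real.exp (-(kappa163 (d + 1) / (d + 1) / 2 * torusSupNorm M (x' - x))) := by
    rw [hE, ← Real.exp_mul]
    congr 1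
    ring
  rw [hexp]
  ring

end Kernel

/-! ## §5 King's pairing on the torus and binder (a)'s format -/

section BinderA

variable (R n : ℕ) [NeZero R] [NeZero n] (M : Fin (d + 1) → ℕ) [hM : ∀ μ, NeZero (M μ)]

/-- **THE DERIVATIVE TWO-LATTICE RATE THROUGH KING'S PAIRING ON THE TORUS.**  For `(pr x′)_ν = ⌊x′_ν∕R⌋` and the typed `∂_νH = fdiff·HkOp` (b05):
`‖(∂′_νH_{Rn})((x′,μ),(y,λ)) − (∂_νH_n)((pr x′,μ),(y,λ))‖ ≤ R_D(n)·e^{−(δ_H∕2)|B(x′) − y|_{T₁}}` with `R_D(n) = √(ρ_D(n)·2MD163·periodConst)`,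
`ρ_D(n) = 2^{1−α}((d+1)∕n)^α K_α + T163(d+1,0,γ)n^{−γ}` — rate `n^{−min(α,γ)∕2}`, decay `δ_H∕2`, uniformly in the volume and in `R`.
[cite: King1986, Prop. 3.8 (3.71) p.664 (second line, shape); Balaban1984PropagatorsI, (1.63) p.28, p.28–29 (the Hölder sentence)] -/
theorem norm_dker_kingPair_sub_le {α γ : ℝ} (hα0 : 0 ≤ α) (hα1 : α < 1) (hγ0 : 0 < γ) (hγ1 : γ < 1)
    (pr : Tor (fine (R * n) M) → Tor (fine n M)) (hpr : ∀ x' ν, (pr x' ν).val = (x' ν).val / R)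
    (μ lam ν : Fin (d + 1)) (x' : Tor (fine (R * n) M)) (y : Tor M) :
    ‖(B5Prop11Plancherel.fdiff (fine (R * n) M) ((R * n : ℕ) : ℂ) ν * HkOp (R * n) M) (x', μ) (y, lam)
        - (B5Prop11Plancherel.fdiff (fine n M) (n : ℂ) ν * HkOp n M) (pr x', μ) (y, lam)‖
      ≤ (2 ^ (1 - α) * (((d + 1 : ℕ) : ℝ) / n) ^ α * (C0maj (d + 1) * (Real.pi * Real.pi ^ α) + C1maj (d + 1) * aliasConst (d + 1) α)
            + T163 (d + 1) 0 γ / (n : ℝ) ^ γ) ^ (1 / 2 : ℝ)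
          * (2 * (MD163 (d + 1) * periodConst (kappa163 (d + 1)) d)) ^ (1 / 2 : ℝ)
          * Real.exp (-(kappa163 (d + 1) / (d + 1) / 2 * tdistT M (blockOf (R * n) M x') y)) := by
  obtain ⟨⟨y', a'⟩, hx⟩ := (bpt_bijective (R * n) M).2 x'
  simp only at hx
  subst hx
  let ah : Fin (d + 1) → Fin n := fun i => ⟨(a' i : ℕ) / R, Nat.div_lt_of_lt_mul (a' i).isLt⟩
  have hover : ∀ i, (a' i : ℕ) / R = (ah i : ℕ) := fun i => rfl
  rw [fdiff_HkOp_apply, fdiff_HkOp_apply, pr_bpt R n M pr hpr y' a' ah hover, blockOf_bpt_king, tdistT_eq_torusSupNorm_rep]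
  have h := norm_dker_twoLattice_sub_le_decay R n M hα0 hα1 hγ0 hγ1 μ lam ν a' ah hover (rep M y') (rep M y)
  rwa [toT_rep, toT_rep] at h

/-- The real part of the typed `∂_νH_k`'s entries IS a real linear map of unit-lattice 1-forms (the binders `hD`, `hD′` below are inhabited). [folklore] -/
theorem exists_reDHkLin (N : ℕ) [NeZero N] (ν : Fin (d + 1)) :
    ∃ D : (Tor M × Fin (d + 1) → ℝ) →ₗ[ℝ] (Tor (fine N M) × Fin (d + 1) → ℝ),
      ∀ b i, D (Pi.single b 1) i = ((B5Prop11Plancherel.fdiff (fine N M) (N : ℂ) ν * HkOp N M) i b).re := by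
  refine ⟨Matrix.mulVecLin ((B5Prop11Plancherel.fdiff (fine N M) (N : ℂ) ν * HkOp N M).map Complex.reLm), fun b i => ?_⟩
  simp [Matrix.mulVec, dotProduct, Pi.single_apply, Matrix.map_apply]

/-- **THE DERIVATIVE ENTRY IN BINDER (a)'s FORMAT** (the NE2⁰ derivative entry `𝔇(D₁′, D₁)` of n15-b's `…N15BackgroundEntries` for `D₁ = ∇_νH`, vector
`U = 1` model): for the real parts of the typed `∂′_νH_{Rn}`, `∂_νH_n` (entry binders `hD′`, `hD`), King's pairing of fine bonds, ANY [B6] carrier and site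
assignments with the unit-torus dominance `δ·d(blk₂(x′,μ), blk₁(y,λ)) ≤ (δ_H∕2)·|B(x′) − y|_{T₁}`, `n₀` unit bonds per cube: `𝔇(∂′H′, ∂H)` through
(identity, pull-back) has the block majorant `n₀·R_D(n)·e^{−δd(y,y′)}` (flat weight). [cite: King1986, Prop. 3.8 (3.71) p.664 (second line, shape); Balaban1985BackgroundPropagators, (3.42) p.397 (second entry: the format's use)] -/
theorem hasMaj_idef_dhk163 {α γ : ℝ} (hα0 : 0 ≤ α) (hα1 : α < 1) (hγ0 : 0 < γ) (hγ1 : γ < 1) (ν : Fin (d + 1))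
    {g : B6.Geometry} [DecidableEq g.Site] (blk₁ : Tor M × Fin (d + 1) → g.Site)
    (blk₂ : Tor (fine (R * n) M) × Fin (d + 1) → g.Site) {n₀ : ℕ} (hn₀ : ∀ y', (fibre blk₁ y').card ≤ n₀)
    (pr : Tor (fine (R * n) M) → Tor (fine n M)) (hpr : ∀ x' ν, (pr x' ν).val = (x' ν).val / R)
    (prV : Tor (fine (R * n) M) × Fin (d + 1) → Tor (fine n M) × Fin (d + 1)) (hprV : ∀ i, prV i = (pr i.1, i.2))
    (D : (Tor M × Fin (d + 1) → ℝ) →ₗ[ℝ] (Tor (fine n M) × Fin (d + 1) → ℝ))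
    (hD : ∀ b i, D (Pi.single b 1) i = ((B5Prop11Plancherel.fdiff (fine n M) (n : ℂ) ν * HkOp n M) i b).re)
    (D' : (Tor M × Fin (d + 1) → ℝ) →ₗ[ℝ] (Tor (fine (R * n) M) × Fin (d + 1) → ℝ))
    (hD' : ∀ b i, D' (Pi.single b 1) i = ((B5Prop11Plancherel.fdiff (fine (R * n) M) ((R * n : ℕ) : ℂ) ν * HkOp (R * n) M) i b).re)
    {δ : ℝ} (hdom : ∀ (i : Tor (fine (R * n) M) × Fin (d + 1)) (b : Tor M × Fin (d + 1)),
      δ * g.dist (blk₂ i) (blk₁ b) ≤ kappa163 (d + 1) / (d + 1) / 2 * tdistT M (blockOf (R * n) M i.1) b.1) :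
    HasMaj (BlockNorm.ofBlocks g blk₁) (BlockNorm.ofBlocks g blk₂) (idef LinearMap.id (pull prV) D' D)
      (fun y y' => n₀ * ((2 ^ (1 - α) * (((d + 1 : ℕ) : ℝ) / n) ^ α *
              (C0maj (d + 1) * (Real.pi * Real.pi ^ α) + C1maj (d + 1) * aliasConst (d + 1) α) + T163 (d + 1) 0 γ / (n : ℝ) ^ γ) ^ (1 / 2 : ℝ)
            * (2 * (MD163 (d + 1) * periodConst (kappa163 (d + 1)) d)) ^ (1 / 2 : ℝ)) *
        Real.exp (-(δ * g.dist y y'))) := by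
  set C : ℝ := (2 ^ (1 - α) * (((d + 1 : ℕ) : ℝ) / n) ^ α *
        (C0maj (d + 1) * (Real.pi * Real.pi ^ α) + C1maj (d + 1) * aliasConst (d + 1) α) + T163 (d + 1) 0 γ / (n : ℝ) ^ γ) ^ (1 / 2 : ℝ)
      * (2 * (MD163 (d + 1) * periodConst (kappa163 (d + 1)) d)) ^ (1 / 2 : ℝ) with hCdef
  have hC : 0 ≤ C := mul_nonneg (Real.rpow_nonneg (rateD_nonneg n hα0 hα1 hγ0 hγ1 ν ν ν) _)
    (Real.rpow_nonneg (mul_nonneg zero_le_two (B5Hk163TorusHolderDecay.CdecD_nonneg (d := d))) _)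
  have key := hasMaj_ofBlocks_of_entry_le blk₁ blk₂ (T := idef LinearMap.id (pull prV) D' D)
    (κ := fun y y' => C * Real.exp (-(δ * g.dist y y'))) (fun _ _ => mul_nonneg hC (Real.exp_nonneg _)) hn₀
    fun i b => by
      rw [idef_id_pull_single_apply, hD', hD, hprV, ← Complex.sub_re]
      refine (Complex.abs_re_le_norm _).trans
        ((norm_dker_kingPair_sub_le R n M hα0 hα1 hγ0 hγ1 pr hpr i.2 b.2 ν i.1 b.1).trans ?_)
      exact mul_le_mul_of_nonneg_left (Real.exp_le_exp.mpr (by linarith [hdom i b])) hC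
  exact key.mono fun y y' => le_of_eq (by rw [hCdef]; ring)

end BinderA

end Summit.QuantumFields.YangMills.BalabanUVNodes.N15.DefectKernel
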